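/-
Copyright (c) 2026 the pub-hodgecm-mathlib formalisation cell (harness21).  Prover seat hodgecm-mathlib-F0P3a-p07 (g14): «S3-ram» seeding wave (LEAD F0P3a-plan (g12∕g13);
owner F0P3a-p06 (g15)), (T2) G-side organ (Cnt2′), sub-organ (z1-a) «EVERY AXIS LATTICE HAS AN ENDOSCOPIC BLOCK FRAME»; 2026-09-02.
-/
import Literature.NumberTheory.Automorphic.UnitaryLatticeTreeAxisEndoFrame   -- ★ p847645 (this seat): (z1-b), `coe_endoGL_eq_endoShape`, `det_endoShape`; brings ★ `latt_mul_eq_of_isIntMatrix`, `mem_latt_iff_of_isUnit`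
import HarnessLib

/-!
# Every lattice `M = latt g ⊆ K³` with `e₁ ∈ M` and integral middle coordinates is an axis lattice `latt ι(g₂, 1)` (Bruhat–Tits 1972 §10; Serre, Trees II.1.1)

Topic `NumberTheory/Automorphic`; namespace `Literature.NumberTheory.Automorphic.UnitaryLatticeTree`.  THEOREMS ONLY (no definition, no instance, no notation, no named fact,
no `sorry`); kernel lane `--supports stmt-HodgeConjecture-24833`; datum-free (`K` with `Valued K ℤᵐ⁰`).  Cell `pub/hodgecm-mathlib`, crux H413; road «S3-ram» (count-neutral),
(T2) G-side organ (Cnt2′) of F0P3a-p07 (g14)'s skeleton, sub-organ **(z1-a)** of the tube decomposition (architect A-p12 (g24), bus 2026-09-02T01:30Z), companion of ★ (z1-b)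
`UnitaryLatticeTreeAxisEndoFrame`: together they identify the AXIS part (`e₁ ∈ M`) of the fixed self-dual lattices of the frame literal `t₀ = ι(γ_W, u)` with the `γ_W`-fixed self-dual
lattices of the `W`-block, labels included.

THE MATHEMATICS.  Let `M = g·𝒪³` (`g ∈ GL₃(K)`) contain `e₁` and have `|x₁| ≤ 1` for all `x ∈ M` (for a SELF-DUAL `M` the second condition follows from the first when `⟨e₁, e₁⟩` is a
unit: `x₁ = ⟨e₁, x⟩ ∈ 𝒪`).  Write `e₁ = g·λ` with `λ ∈ 𝒪³` and let `a = (g₁₀, g₁₁, g₁₂)` be the middle ROW of `g` (integral, being middle coordinates of the columns `c_j ∈ M`).  Then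
`Σ a_j λ_j = (gλ)₁ = 1`, so some `a_{j₀}λ_{j₀}` is a unit (ultrametric inequality).  The three vectors `w_j := c_j − a_j e₁` lie in `M ∩ W` (`W = ⟨e₀, e₂⟩`) and satisfy
`Σ λ_j w_j = gλ − (Σλ_ja_j)e₁ = 0`, so `w_{j₀}` is an `𝒪`-combination of the other two; hence `{w_j : j ≠ j₀} ∪ {e₁}` is an `𝒪`-basis of `M`: concretely `M = latt (g·U)` with
`U = [e_{j′} − a_{j′}λ | λ | e_{j″} − a_{j″}λ]` (`{j′, j″} = {0,1,2} ∖ {j₀}`), `U ∈ M₃(𝒪)`, `det U = ±λ_{j₀} ∈ 𝒪ˣ`, and `g·U = ι(g₂, 1)` for the `2 × 2` matrix `g₂` of the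
`W`-coordinates of `w_{j′}, w_{j″}`.
* §1 `latt_endoGL_eq_of_mul_eq` — the frame-change bookkeeping (`U ∈ GL₃(𝒪)` ⇒ `latt (gU) = latt g`).
* §2 **`exists_latt_endoGL_eq_of_single_mem`** — the theorem, by the three-way pivot.
* §3 (ED. 2) blockwise coordinates (`coe_endoGL_mulVec_apply`, `mem_latt_endoGL_one_iff`, `pairing_endoShape_apply`) and **`exists_class_latt_endoGL_one_iff`** — p05's
  rank-one CLASS token `∃ y ∈ M, ∃ a, |a| = 1 ∧ |c⁻¹⟨y, (Γ−1)y⟩ − c₀a²| < 1` of an axis vertex is that of its `W`-block when `|c⁻¹(u−1)| < 1` (A-p12 (g24)'s (B-ii) input).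
HONEST LABEL: HC_CM is proved only modulo the 2 remaining named inputs (hLiu418 24832, h413 24833) until rung 0 closes; elementary lattice algebra, no books consequence.

## References
* [BruhatTits1972] F. Bruhat, J. Tits, *Groupes réductifs sur un corps local I*, Publ. Math. IHÉS 41 (1972), §10.
* [Serre1980Trees] J.-P. Serre, *Trees* (1980), Ch. II §1.1 (lattices and bases).
* [Rogawski1990] J. D. Rogawski, *Automorphic Representations of Unitary Groups in Three Variables*, Ann. of Math. Stud. 123 (1990), §4.8 Case (a) p. 53.
-/

set_option autoImplicit false

noncomputable section

open scoped Valued WithZero Matrix MatrixGroups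

namespace Literature.NumberTheory.Automorphic.UnitaryLatticeTree

open Literature.NumberTheory.Automorphic Literature.NumberTheory.Automorphic.HermitianLattice Literature.NumberTheory.Rogawski1990

variable {K : Type*} [Field K] [Valued K ℤᵐ⁰]

/-! ## §1 Frame-change bookkeeping -/

/-- If `U ∈ M₃(𝒪)` has unit determinant and `g·U` is the matrix of `ι(g₂, 1)`, then `latt ι(g₂, 1) = latt g`. [cite: Serre1980Trees, Ch. II §1.1] -/
theorem latt_endoGL_eq_of_mul_eq (g : GL (Fin 3) K) {U : Matrix (Fin 3) (Fin 3) K} (hU : IsIntMatrix U) (hdet : Valued.v U.det = 1) (g₂ : GL (Fin 2) K)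
    (hgU : (g : Matrix (Fin 3) (Fin 3) K) * U = ((endoGL (g₂, (1 : GL (Fin 1) K)) : GL (Fin 3) K) : Matrix (Fin 3) (Fin 3) K)) :
    latt ((endoGL (g₂, (1 : GL (Fin 1) K)) : GL (Fin 3) K) : Matrix (Fin 3) (Fin 3) K) = latt (g : Matrix (Fin 3) (Fin 3) K) := by
  have hdet0 : U.det ≠ 0 := fun h0 => by rw [h0, map_zero] at hdet; exact zero_ne_one hdet
  set Ugl : GL (Fin 3) K := Matrix.GeneralLinearGroup.mkOfDetNeZero U hdet0 with hUgl
  have hcoe : (Ugl : Matrix (Fin 3) (Fin 3) K) = U := by rw [hUgl, Matrix.GeneralLinearGroup.val_mkOfDetNeZero]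
  have hU' : IsIntMatrix ((Ugl⁻¹ : GL (Fin 3) K) : Matrix (Fin 3) (Fin 3) K) := by
    rw [Matrix.coe_units_inv, hcoe]; exact isIntMatrix_nonsing_inv_of_v_det_eq_one hU hdet
  have hprod : g * Ugl = endoGL (g₂, (1 : GL (Fin 1) K)) := Units.ext (by rw [Units.val_mul, hcoe]; exact hgU)
  rw [← hprod]
  exact latt_mul_eq_of_isIntMatrix g Ugl (by rw [hcoe]; exact hU) hU'

/-! ## §2 The axis frame -/

/-- Products and differences of integral elements are integral (valuation bookkeeping). [cite: Serre1980Trees, Ch. II §1.1] -/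
private theorem v_one_sub_mul_le {a b : K} (ha : Valued.v a ≤ 1) (hb : Valued.v b ≤ 1) : Valued.v (1 - a * b) ≤ 1 := by
  refine (Valuation.map_sub _ _ _).trans (max_le (le_of_eq (map_one _)) ?_)
  rw [map_mul]; exact mul_le_one' ha hb

set_option maxHeartbeats 1600000 in
-- three explicit 3 × 3 frames and their products
/-- **EVERY AXIS LATTICE HAS AN ENDOSCOPIC BLOCK FRAME.**  If `M = latt g ⊆ K³` contains `e₁ = (0,1,0)` and every `x ∈ M` has `|x₁| ≤ 1`, then `M = latt ι(g₂, 1)` for some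
`g₂ ∈ GL₂(K)` (`ι = endoGL`: `g₂` on `W = ⟨e₀, e₂⟩`, `1` on `Ke₁`). [cite: BruhatTits1972, §10] [cite: Serre1980Trees, Ch. II §1.1] [cite: Rogawski1990, §4.8 Case (a) p. 53] -/
theorem exists_latt_endoGL_eq_of_single_mem (g : GL (Fin 3) K) (he : (Pi.single 1 1 : Fin 3 → K) ∈ latt (g : Matrix (Fin 3) (Fin 3) K))
    (hax : ∀ x ∈ latt (g : Matrix (Fin 3) (Fin 3) K), Valued.v (x 1) ≤ 1) :
    ∃ g₂ : GL (Fin 2) K, latt ((endoGL (g₂, (1 : GL (Fin 1) K)) : GL (Fin 3) K) : Matrix (Fin 3) (Fin 3) K) = latt (g : Matrix (Fin 3) (Fin 3) K) := by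
  set gm : Matrix (Fin 3) (Fin 3) K := (g : Matrix (Fin 3) (Fin 3) K) with hgm
  have hgu : IsUnit gm.det := Matrix.isUnits_det_units g
  -- `λ := g⁻¹ e₁ ∈ 𝒪³`, `g λ = e₁`
  set lam : Fin 3 → K := gm⁻¹ *ᵥ (Pi.single 1 1 : Fin 3 → K) with hlam
  have hlamO : ∀ i, Valued.v (lam i) ≤ 1 := (mem_latt_iff_of_isUnit hgu _).1 he
  have hglam : gm *ᵥ lam = Pi.single 1 1 := by rw [hlam, Matrix.mulVec_mulVec, Matrix.mul_nonsing_inv _ hgu, Matrix.one_mulVec]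
  have hrow : ∀ i, ∑ j, gm i j * lam j = (Pi.single (1 : Fin 3) (1 : K) : Fin 3 → K) i := fun i => by
    have h := congrFun hglam i; rwa [Matrix.mulVec, dotProduct] at h
  have hr0 : gm 0 0 * lam 0 + gm 0 1 * lam 1 + gm 0 2 * lam 2 = 0 := by have h := hrow 0; simpa [Fin.sum_univ_three] using h
  have hr1 : gm 1 0 * lam 0 + gm 1 1 * lam 1 + gm 1 2 * lam 2 = 1 := by have h := hrow 1; simpa [Fin.sum_univ_three] using h
  have hr2 : gm 2 0 * lam 0 + gm 2 1 * lam 1 + gm 2 2 * lam 2 = 0 := by have h := hrow 2; simpa [Fin.sum_univ_three] using h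
  -- the middle row `a_j = g₁ⱼ` is integral (middle coordinates of the columns of `g`)
  have ha : ∀ j, Valued.v (gm 1 j) ≤ 1 := fun j => by
    have h := hax _ (mulVec_single_mem_latt gm j)
    rwa [Matrix.mulVec_single_one] at h
  -- a unit pivot `a_{j₀} λ_{j₀}`
  have hpiv : ∃ j₀ : Fin 3, Valued.v (gm 1 j₀ * lam j₀) = 1 := by
    by_contra hne
    push Not at hne
    have hlt : ∀ j ∈ (Finset.univ : Finset (Fin 3)), Valued.v (gm 1 j * lam j) < 1 := fun j _ =>
      lt_of_le_of_ne (by rw [map_mul]; exact mul_le_one' (ha j) (hlamO j)) (hne j)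
    have h := Valuation.map_sum_lt (Valued.v : Valuation K ℤᵐ⁰) one_ne_zero hlt
    rw [hrow 1, Pi.single_eq_same, map_one] at h
    exact lt_irrefl _ h
  obtain ⟨j₀, hj₀⟩ := hpiv
  have hlam0 : Valued.v (lam j₀) = 1 := by
    refine le_antisymm (hlamO j₀) ?_
    have h : (1 : ℤᵐ⁰) ≤ Valued.v (gm 1 j₀) * Valued.v (lam j₀) := by rw [← map_mul, hj₀]
    calc (1 : ℤᵐ⁰) ≤ Valued.v (gm 1 j₀) * Valued.v (lam j₀) := h
      _ ≤ 1 * Valued.v (lam j₀) := mul_le_mul' (ha j₀) le_rfl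
      _ = _ := one_mul _
  have hdetg : gm.det ≠ 0 := hgu.ne_zero
  -- the three pivots
  have hj : j₀ = 0 ∨ j₀ = 1 ∨ j₀ = 2 := by fin_cases j₀ <;> simp
  rcases hj with rfl | rfl | rfl
  · -- pivot `j₀ = 0`: keep the columns `1` and `2`
    set U : Matrix (Fin 3) (Fin 3) K := !![-(gm 1 1 * lam 0), lam 0, -(gm 1 2 * lam 0); 1 - gm 1 1 * lam 1, lam 1, -(gm 1 2 * lam 1); -(gm 1 1 * lam 2), lam 2, 1 - gm 1 2 * lam 2] with hUdef
    have hUint : IsIntMatrix U := by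
      intro i j
      fin_cases i <;> fin_cases j <;> simp [U, v_one_sub_mul_le, mul_le_one', ha, hlamO]
    have hUdet : U.det = -lam 0 := by rw [hUdef, Matrix.det_fin_three]; simp; ring
    have hvU : Valued.v U.det = 1 := by rw [hUdet, Valuation.map_neg]; exact hlam0
    set G₂ : Matrix (Fin 2) (Fin 2) K := !![gm 0 1, gm 0 2; gm 2 1, gm 2 2] with hG₂
    have hgU : gm * U = !![G₂ 0 0, 0, G₂ 0 1; 0, 1, 0; G₂ 1 0, 0, G₂ 1 1] := by
      ext i j
      fin_cases i <;> fin_cases j <;> simp [U, G₂, Matrix.mul_apply, Fin.sum_univ_three]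
      · linear_combination (-(gm 1 1)) * hr0
      · linear_combination hr0
      · linear_combination (-(gm 1 2)) * hr0
      · linear_combination (-(gm 1 1)) * hr1
      · linear_combination hr1
      · linear_combination (-(gm 1 2)) * hr1
      · linear_combination (-(gm 1 1)) * hr2
      · linear_combination hr2
      · linear_combination (-(gm 1 2)) * hr2
    have hG₂det : G₂.det ≠ 0 := by
      intro h0
      have h1 : (gm * U).det = 0 := by rw [hgU, det_endoShape, h0, zero_mul]
      rw [Matrix.det_mul, hUdet] at h1
      rcases mul_eq_zero.1 h1 with h | h
      · exact hdetg h
      · have hl := hlam0; rw [neg_eq_zero.1 h, map_zero] at hl; exact zero_ne_one hl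
    set g₂ : GL (Fin 2) K := Matrix.GeneralLinearGroup.mkOfDetNeZero G₂ hG₂det with hg₂
    have hE : ((endoGL (g₂, (1 : GL (Fin 1) K)) : GL (Fin 3) K) : Matrix (Fin 3) (Fin 3) K) = !![G₂ 0 0, 0, G₂ 0 1; 0, 1, 0; G₂ 1 0, 0, G₂ 1 1] := by
      rw [coe_endoGL_eq_endoShape, hg₂, Matrix.GeneralLinearGroup.val_mkOfDetNeZero, Units.val_one, Matrix.one_apply_eq]
    exact ⟨g₂, latt_endoGL_eq_of_mul_eq g hUint hvU g₂ (hgU.trans hE.symm)⟩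
  · -- pivot `j₀ = 1`: keep the columns `0` and `2`
    set U : Matrix (Fin 3) (Fin 3) K := !![1 - gm 1 0 * lam 0, lam 0, -(gm 1 2 * lam 0); -(gm 1 0 * lam 1), lam 1, -(gm 1 2 * lam 1); -(gm 1 0 * lam 2), lam 2, 1 - gm 1 2 * lam 2] with hUdef
    have hUint : IsIntMatrix U := by
      intro i j
      fin_cases i <;> fin_cases j <;> simp [U, v_one_sub_mul_le, mul_le_one', ha, hlamO]
    have hUdet : U.det = lam 1 := by rw [hUdef, Matrix.det_fin_three]; simp; ring
    have hvU : Valued.v U.det = 1 := by rw [hUdet]; exact hlam0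
    set G₂ : Matrix (Fin 2) (Fin 2) K := !![gm 0 0, gm 0 2; gm 2 0, gm 2 2] with hG₂
    have hgU : gm * U = !![G₂ 0 0, 0, G₂ 0 1; 0, 1, 0; G₂ 1 0, 0, G₂ 1 1] := by
      ext i j
      fin_cases i <;> fin_cases j <;> simp [U, G₂, Matrix.mul_apply, Fin.sum_univ_three]
      · linear_combination (-(gm 1 0)) * hr0
      · linear_combination hr0
      · linear_combination (-(gm 1 2)) * hr0
      · linear_combination (-(gm 1 0)) * hr1
      · linear_combination hr1
      · linear_combination (-(gm 1 2)) * hr1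
      · linear_combination (-(gm 1 0)) * hr2
      · linear_combination hr2
      · linear_combination (-(gm 1 2)) * hr2
    have hG₂det : G₂.det ≠ 0 := by
      intro h0
      have h1 : (gm * U).det = 0 := by rw [hgU, det_endoShape, h0, zero_mul]
      rw [Matrix.det_mul, hUdet] at h1
      rcases mul_eq_zero.1 h1 with h | h
      · exact hdetg h
      · have hl := hlam0; rw [h, map_zero] at hl; exact zero_ne_one hl
    set g₂ : GL (Fin 2) K := Matrix.GeneralLinearGroup.mkOfDetNeZero G₂ hG₂det with hg₂
    have hE : ((endoGL (g₂, (1 : GL (Fin 1) K)) : GL (Fin 3) K) : Matrix (Fin 3) (Fin 3) K) = !![G₂ 0 0, 0, G₂ 0 1; 0, 1, 0; G₂ 1 0, 0, G₂ 1 1] := by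
      rw [coe_endoGL_eq_endoShape, hg₂, Matrix.GeneralLinearGroup.val_mkOfDetNeZero, Units.val_one, Matrix.one_apply_eq]
    exact ⟨g₂, latt_endoGL_eq_of_mul_eq g hUint hvU g₂ (hgU.trans hE.symm)⟩
  · -- pivot `j₀ = 2`: keep the columns `0` and `1`
    set U : Matrix (Fin 3) (Fin 3) K := !![1 - gm 1 0 * lam 0, lam 0, -(gm 1 1 * lam 0); -(gm 1 0 * lam 1), lam 1, 1 - gm 1 1 * lam 1; -(gm 1 0 * lam 2), lam 2, -(gm 1 1 * lam 2)] with hUdef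
    have hUint : IsIntMatrix U := by
      intro i j
      fin_cases i <;> fin_cases j <;> simp [U, v_one_sub_mul_le, mul_le_one', ha, hlamO]
    have hUdet : U.det = -lam 2 := by rw [hUdef, Matrix.det_fin_three]; simp; ring
    have hvU : Valued.v U.det = 1 := by rw [hUdet, Valuation.map_neg]; exact hlam0
    set G₂ : Matrix (Fin 2) (Fin 2) K := !![gm 0 0, gm 0 1; gm 2 0, gm 2 1] with hG₂
    have hgU : gm * U = !![G₂ 0 0, 0, G₂ 0 1; 0, 1, 0; G₂ 1 0, 0, G₂ 1 1] := by
      ext i j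
      fin_cases i <;> fin_cases j <;> simp [U, G₂, Matrix.mul_apply, Fin.sum_univ_three]
      · linear_combination (-(gm 1 0)) * hr0
      · linear_combination hr0
      · linear_combination (-(gm 1 1)) * hr0
      · linear_combination (-(gm 1 0)) * hr1
      · linear_combination hr1
      · linear_combination (-(gm 1 1)) * hr1
      · linear_combination (-(gm 1 0)) * hr2
      · linear_combination hr2
      · linear_combination (-(gm 1 1)) * hr2
    have hG₂det : G₂.det ≠ 0 := by
      intro h0
      have h1 : (gm * U).det = 0 := by rw [hgU, det_endoShape, h0, zero_mul]
      rw [Matrix.det_mul, hUdet] at h1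
      rcases mul_eq_zero.1 h1 with h | h
      · exact hdetg h
      · have hl := hlam0; rw [neg_eq_zero.1 h, map_zero] at hl; exact zero_ne_one hl
    set g₂ : GL (Fin 2) K := Matrix.GeneralLinearGroup.mkOfDetNeZero G₂ hG₂det with hg₂
    have hE : ((endoGL (g₂, (1 : GL (Fin 1) K)) : GL (Fin 3) K) : Matrix (Fin 3) (Fin 3) K) = !![G₂ 0 0, 0, G₂ 0 1; 0, 1, 0; G₂ 1 0, 0, G₂ 1 1] := by
      rw [coe_endoGL_eq_endoShape, hg₂, Matrix.GeneralLinearGroup.val_mkOfDetNeZero, Units.val_one, Matrix.one_apply_eq]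
    exact ⟨g₂, latt_endoGL_eq_of_mul_eq g hUint hvU g₂ (hgU.trans hE.symm)⟩

/-! ## §3 (ED. 2) Coordinates and the rank-one CLASS token along the axis frame -/

omit [Valued K ℤᵐ⁰] in
/-- The block frame acts blockwise on vectors: `ι(a, b)·y = (a·(y₀, y₂) on W, b·y₁ on e₁)`. [cite: Rogawski1990, §4.8 Case (a) p. 53] -/
theorem coe_endoGL_mulVec_apply (a : GL (Fin 2) K) (b : GL (Fin 1) K) (y : Fin 3 → K) :
    ((endoGL (a, b) : GL (Fin 3) K) : Matrix (Fin 3) (Fin 3) K) *ᵥ y =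
      ![((a : Matrix (Fin 2) (Fin 2) K) *ᵥ ![y 0, y 2]) 0, (b : Matrix (Fin 1) (Fin 1) K) 0 0 * y 1, ((a : Matrix (Fin 2) (Fin 2) K) *ᵥ ![y 0, y 2]) 1] := by
  rw [coe_endoGL_eq_endoShape]
  ext i
  fin_cases i <;> simp [Matrix.mulVec, dotProduct, Fin.sum_univ_three, Fin.sum_univ_two]

omit [Valued K ℤᵐ⁰] in
/-- `ι(a, b) − 1` acts blockwise: `(ι(a,b) − 1)·y = ((a − 1)·(y₀, y₂), (b − 1)·y₁)`. [cite: Rogawski1990, §4.8 Case (a) p. 53] -/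
theorem coe_endoGL_sub_one_mulVec_apply (a : GL (Fin 2) K) (b : GL (Fin 1) K) (y : Fin 3 → K) :
    (((endoGL (a, b) : GL (Fin 3) K) : Matrix (Fin 3) (Fin 3) K) - 1) *ᵥ y =
      ![(((a : Matrix (Fin 2) (Fin 2) K) - 1) *ᵥ ![y 0, y 2]) 0, ((b : Matrix (Fin 1) (Fin 1) K) 0 0 - 1) * y 1, (((a : Matrix (Fin 2) (Fin 2) K) - 1) *ᵥ ![y 0, y 2]) 1] := by
  rw [coe_endoGL_sub_one_eq_endoShape]
  ext i
  fin_cases i <;> simp [Matrix.mulVec, dotProduct, Fin.sum_univ_three, Fin.sum_univ_two]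

omit [Valued K ℤᵐ⁰] in
/-- The pairing of a block form splits along the blocks. [cite: Jacobowitz1962, §4] [cite: Rogawski1990, §4.8 Case (a) p. 53] -/
theorem pairing_endoShape_apply (σ : K →+* K) (H₂ : Matrix (Fin 2) (Fin 2) K) (h : K) (x y : Fin 3 → K) :
    pairing σ (!![H₂ 0 0, 0, H₂ 0 1; 0, h, 0; H₂ 1 0, 0, H₂ 1 1] : Matrix (Fin 3) (Fin 3) K) x y =
      pairing σ H₂ ![x 0, x 2] ![y 0, y 2] + σ (x 1) * h * y 1 := by
  simp [pairing_apply, Fin.sum_univ_three, Fin.sum_univ_two]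
  ring

/-- **MEMBERSHIP IN AN AXIS LATTICE IS BLOCKWISE**: `y ∈ latt ι(g₂, 1) ⟺ (y₀, y₂) ∈ latt g₂ ∧ |y₁| ≤ 1`. [cite: BruhatTits1972, §10] [cite: Serre1980Trees, Ch. II §1.1] -/
theorem mem_latt_endoGL_one_iff (g₂ : GL (Fin 2) K) (y : Fin 3 → K) :
    y ∈ latt ((endoGL (g₂, (1 : GL (Fin 1) K)) : GL (Fin 3) K) : Matrix (Fin 3) (Fin 3) K) ↔
      ![y 0, y 2] ∈ latt (g₂ : Matrix (Fin 2) (Fin 2) K) ∧ Valued.v (y 1) ≤ 1 := by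
  have hG : IsUnit ((((endoGL (g₂, (1 : GL (Fin 1) K)) : GL (Fin 3) K) : Matrix (Fin 3) (Fin 3) K)).det) := Matrix.isUnits_det_units _
  have hg : IsUnit ((g₂ : Matrix (Fin 2) (Fin 2) K)).det := Matrix.isUnits_det_units _
  rw [mem_latt_iff_of_isUnit hG, mem_latt_iff_of_isUnit hg, ← Matrix.coe_units_inv, ← Matrix.coe_units_inv,
    show ((endoGL (g₂, (1 : GL (Fin 1) K)))⁻¹ : GL (Fin 3) K) = endoGL (g₂⁻¹, (1 : GL (Fin 1) K)) by rw [← map_inv, Prod.inv_mk, inv_one],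
    coe_endoGL_mulVec_apply, Units.val_one, Matrix.one_apply_eq, one_mul]
  constructor
  · intro h
    refine ⟨fun i => ?_, by simpa using h 1⟩
    fin_cases i
    · simpa using h 0
    · simpa using h 2
  · rintro ⟨h, h1⟩ i
    fin_cases i
    · simpa using h 0
    · simpa using h1
    · simpa using h 1

/-- **THE RANK-ONE CLASS TOKEN OF AN AXIS VERTEX IS THAT OF ITS W-BLOCK** (block form `H = ι-shape(H₂, h)` with `|h| ≤ 1`, scale `c` with `|c⁻¹(u − 1)| < 1` — e.g. `c = ϖ_w`, `u`
2-deep): `(∃ y ∈ latt ι(g₂,1), ∃ a, |a| = 1 ∧ |c⁻¹·⟨y, (ι(γ₂,u) − 1)y⟩_H − c₀·a²| < 1) ⟺ (∃ y₂ ∈ latt g₂, ∃ a, |a| = 1 ∧ |c⁻¹·⟨y₂, (γ₂ − 1)y₂⟩_{H₂} − c₀·a²| < 1)` — p05's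
lattice `CLS` token (★ `ncard_fixedBy_interior_{sq,nonsq}_eq_…`) read on the `W`-side (A-p12 (g24)'s (B-ii) shell class law input). [cite: Kottwitz1986, §3] [cite: BruhatTits1972, §10] -/
theorem exists_class_latt_endoGL_one_iff (σ : K →+* K) (hvσ : ∀ a, Valued.v (σ a) = Valued.v a) (H₂ : Matrix (Fin 2) (Fin 2) K) {h : K} (hh : Valued.v h ≤ 1)
    (g₂ γ₂ : GL (Fin 2) K) (u : GL (Fin 1) K) {c : K} (hu : Valued.v (c⁻¹ * ((u : Matrix (Fin 1) (Fin 1) K) 0 0 - 1)) < 1) (c₀ : K) :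
    (∃ y ∈ latt ((endoGL (g₂, (1 : GL (Fin 1) K)) : GL (Fin 3) K) : Matrix (Fin 3) (Fin 3) K), ∃ a : K, Valued.v a = 1 ∧
        Valued.v (c⁻¹ * pairing σ (!![H₂ 0 0, 0, H₂ 0 1; 0, h, 0; H₂ 1 0, 0, H₂ 1 1] : Matrix (Fin 3) (Fin 3) K) y
          ((((endoGL (γ₂, u) : GL (Fin 3) K) : Matrix (Fin 3) (Fin 3) K) - 1) *ᵥ y) - c₀ * a ^ 2) < 1) ↔
      (∃ y₂ ∈ latt (g₂ : Matrix (Fin 2) (Fin 2) K), ∃ a : K, Valued.v a = 1 ∧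
        Valued.v (c⁻¹ * pairing σ H₂ y₂ ((((γ₂ : Matrix (Fin 2) (Fin 2) K)) - 1) *ᵥ y₂) - c₀ * a ^ 2) < 1) := by
  -- the block split of the value `⟨y, (Γ − 1)y⟩`
  have hsplit : ∀ y : Fin 3 → K,
      pairing σ (!![H₂ 0 0, 0, H₂ 0 1; 0, h, 0; H₂ 1 0, 0, H₂ 1 1] : Matrix (Fin 3) (Fin 3) K) y
          ((((endoGL (γ₂, u) : GL (Fin 3) K) : Matrix (Fin 3) (Fin 3) K) - 1) *ᵥ y) =
        pairing σ H₂ ![y 0, y 2] ((((γ₂ : Matrix (Fin 2) (Fin 2) K)) - 1) *ᵥ ![y 0, y 2]) + σ (y 1) * h * (((u : Matrix (Fin 1) (Fin 1) K) 0 0 - 1) * y 1) := by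
    intro y
    rw [coe_endoGL_sub_one_mulVec_apply, pairing_endoShape_apply]
    congr 1
  -- the middle term is negligible at the scale `c` for `y₁ ∈ 𝒪`
  have hneg : ∀ y : Fin 3 → K, Valued.v (y 1) ≤ 1 → Valued.v (c⁻¹ * (σ (y 1) * h * (((u : Matrix (Fin 1) (Fin 1) K) 0 0 - 1) * y 1))) < 1 := by
    intro y hy
    have hre : c⁻¹ * (σ (y 1) * h * (((u : Matrix (Fin 1) (Fin 1) K) 0 0 - 1) * y 1)) = (σ (y 1) * h * y 1) * (c⁻¹ * ((u : Matrix (Fin 1) (Fin 1) K) 0 0 - 1)) := by ring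
    rw [hre, map_mul]
    refine mul_lt_one_of_nonneg_of_lt_one_right ?_ zero_le hu
    rw [map_mul, map_mul, hvσ]
    exact mul_le_one' (mul_le_one' hy hh) hy
  -- ultrametric: `|X + E − s| < 1 ⟺ |X − s| < 1` when `|E| < 1`
  have hult : ∀ X E s : K, Valued.v E < 1 → (Valued.v (X + E - s) < 1 ↔ Valued.v (X - s) < 1) := by
    intro X E s hE
    constructor
    · intro hlt
      have hre : X - s = (X + E - s) - E := by ring
      rw [hre]; exact lt_of_le_of_lt (Valuation.map_sub _ _ _) (max_lt hlt hE)
    · intro hlt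
      have hre : X + E - s = (X - s) + E := by ring
      rw [hre]; exact lt_of_le_of_lt (Valuation.map_add _ _ _) (max_lt hlt hE)
  constructor
  · rintro ⟨y, hy, a, ha, hcl⟩
    obtain ⟨hyW, hy1⟩ := (mem_latt_endoGL_one_iff g₂ y).1 hy
    refine ⟨![y 0, y 2], hyW, a, ha, ?_⟩
    rw [hsplit y, mul_add] at hcl
    exact (hult _ _ _ (hneg y hy1)).1 hcl
  · rintro ⟨y₂, hy₂, a, ha, hcl⟩
    refine ⟨![y₂ 0, 0, y₂ 1], (mem_latt_endoGL_one_iff g₂ _).2 ⟨?_, by simp⟩, a, ha, ?_⟩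
    · have e : (![(![y₂ 0, 0, y₂ 1] : Fin 3 → K) 0, (![y₂ 0, 0, y₂ 1] : Fin 3 → K) 2] : Fin 2 → K) = y₂ := by
        ext i; fin_cases i <;> simp
      rw [e]; exact hy₂
    · rw [hsplit, mul_add]
      have e : (![(![y₂ 0, 0, y₂ 1] : Fin 3 → K) 0, (![y₂ 0, 0, y₂ 1] : Fin 3 → K) 2] : Fin 2 → K) = y₂ := by
        ext i; fin_cases i <;> simp
      rw [e]
      refine (hult _ _ _ (hneg _ (by simp))).2 hcl

end Literature.NumberTheory.Automorphic.UnitaryLatticeTree
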